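import Summits.ABC.StewartYu.PadicG3TwoThirdReindex
import HarnessLib

/-!
# Cell abc-stewartyu, Gen-3 frame at `p = 2` (crux `Y07Two`, stmt-ABC-19659), layer F5d v2: BASE-RELATIVE
# re-indexing after the Kummer `3`-descent — `κ′ = (κ − κ_{i₁})/3` for a base unknown `i₁` of the class

`Summits/ABC/StewartYu/PadicG3TwoThirdReindexR.lean` — cell `abc-stewartyu` (HOME `run/shared/lean/pub/abc-stewartyu/`),
route `PadicPrimesKummerThird`, seat p5 (g3); sequel to `PadicG3TwoThirdReindex.lean`.  One definition
(`G3Fam.reindex3R`) and theorems; no named fact.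

WHY v2 (record flag p1-g7, 2026-08-27T02:31Z): v1's `reindex3` subtracts the ABSOLUTE representative `v̂ ∈ {0,1,2}`,
`κ′ = (κ − v̂)/3`, so the exponent boxes obey `D ↦ (D+2)/3` and FLOOR AT `1`; the far-height line of the record
(`2|x|·∑ Dⱼ·h(αⱼ)` at ranges `|x| ≍ 3^I·X`) then does not decay with the level and no admissible `L` closes it.
Print subtracts a BASE POINT of the class (Nesterenko LNM 1819 (4.35): `λ̄ = 𝐥 − 𝐯_s`, `|λ̄ⱼ| ≤ 2^{−s}L/Aⱼ`;
Yu 2013 (5.1)(i): `µ − µ⁽ᴵ⁾ ∈ q^{−I}C`): `κᵢ′ = (κᵢ − κ_{i₁})/3` for the new base `i₁ ∈ B_v` (exact division, both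
`≡ v (mod 3)`), so the level-`I` exponents are `(λᵢ − λ♭)/3^I` for points of the ORIGINAL box and `|κᵢ′| ≤ 2·side/3^I`
— eventually `0`.  The algebra is v1's with the shift `v̂ ↦ κ_{i₁}`: `qPart3 κᵢ s = zmon(κᵢ′, s)·qPart3 κ_{i₁} s`
(`qPart3_eq_of_base`), `zγⱼ(κᵢ) = 3·zγⱼ(κᵢ′) + zγⱼ(κ_{i₁})`, and **`vanish_cop_reindex3R`**: vanishing class sums at
the integers coprime to `3` ⇒ `(Λ.reindex3R i₁).vanish nodesCop N T`.

WHAT THIS IS NOT: no admissibility transport (sequel `PadicG3TwoThirdStepR`); no crux moves.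

References: Yu. V. Nesterenko, LNM 1819 (2003), §4.3 (4.35), (4.45), (4.50)–(4.51); K. Yu, Acta Math. 211 (2013),
Lemma 5.4 (5.50)–(5.57), (5.1)(i).
-/

noncomputable section

open Finset Polynomial
open Literature.NumberTheory.Transcendental
open Literature.NumberTheory.Transcendental.CW77.Setup (Tau tauNorm)

namespace Summit.ABC.StewartYu

namespace TwoSetup

variable (S : TwoSetup) {ι : Type*}

/-! ### Classes relative to an arbitrary base vector -/

/-- On the class of `w` (`res3 κ 1 = res3 w 1`): `κₖ = 3·((κₖ − wₖ)/3) + wₖ`. [folklore] -/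
theorem eq_three_mul_add_of_res3_eq {κ w : Fin (S.d + 1) → ℤ} (h : S.res3 κ 1 = S.res3 w 1)
    (k : Fin (S.d + 1)) : κ k = 3 * ((κ k - w k) / 3) + w k := by
  have hk : κ k % 3 = w k % 3 := by
    rw [← S.res3_one_coe κ k, ← S.res3_one_coe w k, h]
  omega

/-- On the class of `w`, `res3 κ s = res3 w s` for every `s`. [folklore] -/
theorem res3_eq_of_res3_one_eq {κ w : Fin (S.d + 1) → ℤ} (h : S.res3 κ 1 = S.res3 w 1) (s : ℤ) :
    S.res3 κ s = S.res3 w s := by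
  rw [S.res3_eq_of_cls (v := S.res3 w 1) h s, ← S.res3_eq_of_cls (κ := w) (v := S.res3 w 1) rfl s]

/-- **For `3 ∤ s`, the class at `s` determines the class**: `res3 κ s = res3 w s → res3 κ 1 = res3 w 1`.
[cite: Yu2013, (5.44)–(5.45); shape only] -/
theorem res3_one_eq_of_res3_eq {κ w : Fin (S.d + 1) → ℤ} {s : ℤ} (hs : ¬ (3 : ℤ) ∣ s)
    (h : S.res3 κ s = S.res3 w s) : S.res3 κ 1 = S.res3 w 1 := by
  rw [S.res3_eq_of_cls (κ := w) (v := S.res3 w 1) rfl s] at h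
  exact S.cls_eq_of_res3_eq hs h

/-- The unknowns whose class at `s` (`3 ∤ s`) is that of `w` are exactly the class of `w`. [folklore] -/
theorem filter_res3_eq_base_of_not_dvd (u : ι → Fin S.d → ℤ) (uθ : ι → ℤ) (B : Finset ι)
    (w : Fin (S.d + 1) → ℤ) {s : ℤ} (hs : ¬ (3 : ℤ) ∣ s) :
    (B.filter fun i => S.res3 (Fin.snoc (u i) (uθ i)) s = S.res3 w s) =
      B.filter fun i => S.res3 (Fin.snoc (u i) (uθ i)) 1 = S.res3 w 1 := by
  ext i
  simp only [Finset.mem_filter, and_congr_right_iff]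
  intro _
  exact ⟨fun h => S.res3_one_eq_of_res3_eq hs h, fun h => S.res3_eq_of_res3_one_eq h s⟩

/-- **`qPart3 κ s = zmon(κ′, s)·qPart3 w s` for `κ = 3κ′ + w`.** [cite: Yu2013, (5.51)–(5.52); shape only] -/
theorem qPart3_eq_of_base (u' : Fin S.d → ℤ) (uθ' : ℤ) (κ w : Fin (S.d + 1) → ℤ)
    (hκ : ∀ k, κ k = 3 * (Fin.snoc u' uθ' : Fin (S.d + 1) → ℤ) k + w k) (s : ℤ) :
    S.qPart3 κ s = S.zmon u' uθ' s * S.qPart3 w s := by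
  rw [S.zmon_eq_prod_all u' uθ' s]
  unfold qPart3
  rw [← Finset.prod_mul_distrib]
  refine Finset.prod_congr rfl fun k _ => ?_
  rw [← zpow_add₀ (S.toQ.all_ne k)]
  congr 1
  rw [hκ k]
  have e : (3 * (Fin.snoc u' uθ' : Fin (S.d + 1) → ℤ) k + w k) * s =
      w k * s + 3 * ((Fin.snoc u' uθ' : Fin (S.d + 1) → ℤ) k * s) := by ring
  rw [e, Int.add_mul_ediv_left _ _ (by norm_num : (3 : ℤ) ≠ 0)]
  unfold allExp
  refine Fin.lastCases ?_ (fun j => ?_) k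
  · simp only [Fin.snoc_last]; ring
  · simp only [Fin.snoc_castSucc]; ring

/-! ### The base-relative re-indexed family -/

namespace G3Fam

variable {S}

/-- **The BASE-RELATIVE re-indexed family** after a Kummer `3`-descent: the class of the base unknown `i₁`,
exponents `κᵢ′ = (κᵢ − κ_{i₁})/3`, `Y₀`-basis `Rᵢ ∘ (Y₀/3)`, the same coefficients, base point `i₁`.
[cite: Nesterenko2003, §4.3 (4.35), (4.45)] [cite: Yu2013, Lemma 5.4 and (5.1)(i); shape only] -/
def reindex3R (Λ : S.G3Fam ι) (i₁ : ι) : S.G3Fam ι where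
  B := Λ.B.filter fun i => S.res3 (Fin.snoc (Λ.u i) (Λ.uθ i)) 1 = S.res3 (Fin.snoc (Λ.u i₁) (Λ.uθ i₁)) 1
  R := fun i => (Λ.R i).comp (C (3⁻¹ : ℚ) * X)
  u := fun i j => (Λ.u i j - Λ.u i₁ j) / 3
  uθ := fun i => (Λ.uθ i - Λ.uθ i₁) / 3
  p := Λ.p
  i₀ := i₁

variable (Λ : S.G3Fam ι) (i₁ : ι)

/-- Members of the re-indexed family. [folklore] -/
theorem mem_reindex3R_B {i : ι} :
    i ∈ (Λ.reindex3R i₁).B ↔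
      i ∈ Λ.B ∧ S.res3 (Fin.snoc (Λ.u i) (Λ.uθ i)) 1 = S.res3 (Fin.snoc (Λ.u i₁) (Λ.uθ i₁)) 1 := by
  unfold reindex3R; exact Finset.mem_filter

/-- The re-indexed family is a sub-family. [folklore] -/
theorem reindex3R_B_subset : (Λ.reindex3R i₁).B ⊆ Λ.B := by
  unfold reindex3R; exact Finset.filter_subset _ _

/-- The base unknown belongs to its class. [folklore] -/
theorem base_mem_reindex3R (hi₁ : i₁ ∈ Λ.B) : i₁ ∈ (Λ.reindex3R i₁).B :=
  (Λ.mem_reindex3R_B i₁).mpr ⟨hi₁, rfl⟩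

/-- **`κᵢ = 3κᵢ′ + κ_{i₁}` on the class** (all generators). [folklore] -/
theorem snoc_eq_of_memR {i : ι} (hi : i ∈ (Λ.reindex3R i₁).B) (k : Fin (S.d + 1)) :
    (Fin.snoc (Λ.u i) (Λ.uθ i) : Fin (S.d + 1) → ℤ) k =
      3 * (Fin.snoc ((Λ.reindex3R i₁).u i) ((Λ.reindex3R i₁).uθ i) : Fin (S.d + 1) → ℤ) k +
        (Fin.snoc (Λ.u i₁) (Λ.uθ i₁) : Fin (S.d + 1) → ℤ) k := by
  have h := ((Λ.mem_reindex3R_B i₁).mp hi).2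
  refine Fin.lastCases ?_ (fun j => ?_) k
  · have := S.eq_three_mul_add_of_res3_eq h (Fin.last S.d)
    simp only [Fin.snoc_last] at this ⊢
    exact this
  · have := S.eq_three_mul_add_of_res3_eq h (Fin.castSucc j)
    simp only [Fin.snoc_castSucc] at this ⊢
    exact this

/-- `uᵢ j = 3uᵢ′ j + u_{i₁} j` on the class. [folklore] -/
theorem u_eq_of_memR {i : ι} (hi : i ∈ (Λ.reindex3R i₁).B) (j : Fin S.d) :
    Λ.u i j = 3 * (Λ.reindex3R i₁).u i j + Λ.u i₁ j := by
  have := Λ.snoc_eq_of_memR i₁ hi (Fin.castSucc j)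
  simpa only [Fin.snoc_castSucc] using this

/-- `u_θᵢ = 3u_θᵢ′ + u_θ_{i₁}` on the class. [folklore] -/
theorem uθ_eq_of_memR {i : ι} (hi : i ∈ (Λ.reindex3R i₁).B) :
    Λ.uθ i = 3 * (Λ.reindex3R i₁).uθ i + Λ.uθ i₁ := by
  have := Λ.snoc_eq_of_memR i₁ hi (Fin.last S.d)
  simpa only [Fin.snoc_last] using this

/-- **The directional coefficients are affine**: `zγⱼ(κᵢ) = 3·zγⱼ(κᵢ′) + zγⱼ(κ_{i₁})` on the class.
[cite: Nesterenko2003, §4.3 (4.50)] -/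
theorem zγ_eq_of_memR {i : ι} (hi : i ∈ (Λ.reindex3R i₁).B) (j : Fin S.d) :
    S.zγ (Λ.u i) (Λ.uθ i) j =
      3 * S.zγ ((Λ.reindex3R i₁).u i) ((Λ.reindex3R i₁).uθ i) j + S.zγ (Λ.u i₁) (Λ.uθ i₁) j := by
  unfold zγ
  rw [Λ.u_eq_of_memR i₁ hi j, Λ.uθ_eq_of_memR i₁ hi]
  push_cast
  ring

end G3Fam

/-! ### From vanishing class sums to the base-relative family's native identities -/

/-- The class sum of `i₁`'s class at `3 ∤ s`, on the base-relative family: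
`thirdVec B p τ s (res3 κ_{i₁} s) = 3^{t₀}·qPart3 κ_{i₁} s·∑_{i ∈ B'} pᵢ·(Hasse_{t₀}Rᵢ′)(s)·∏ⱼ zγⱼ(κᵢ)^{tⱼ}·zmon(κᵢ′,s)`.
[cite: Yu2013, (5.50)–(5.53); shape only] -/
theorem thirdVec_base_eq (Λ : S.G3Fam ι) (i₁ : ι) (τ : Tau S.d) {s : ℤ} (hs : ¬ (3 : ℤ) ∣ s) :
    S.thirdVec Λ.R Λ.u Λ.uθ Λ.B Λ.p τ s (S.res3 (Fin.snoc (Λ.u i₁) (Λ.uθ i₁)) s) =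
      (3 : ℚ) ^ τ.1 * S.qPart3 (Fin.snoc (Λ.u i₁) (Λ.uθ i₁)) s *
        ∑ i ∈ (Λ.reindex3R i₁).B, (Λ.p i : ℚ) *
          (hasseDeriv τ.1 ((Λ.reindex3R i₁).R i)).eval (s : ℚ) * S.zγpow Λ.u Λ.uθ i τ.2 *
            S.zmon ((Λ.reindex3R i₁).u i) ((Λ.reindex3R i₁).uθ i) s := by
  unfold thirdVec
  rw [S.filter_res3_eq_base_of_not_dvd Λ.u Λ.uθ Λ.B _ hs]
  change ∑ i ∈ (Λ.reindex3R i₁).B, _ = _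
  rw [Finset.mul_sum]
  refine Finset.sum_congr rfl fun i hi => ?_
  rw [S.qPart3_eq_of_base ((Λ.reindex3R i₁).u i) ((Λ.reindex3R i₁).uθ i) _ _
      (Λ.snoc_eq_of_memR i₁ hi) s, eval_hasseDeriv_comp_third]
  unfold G3Fam.reindex3R
  simp only
  ring

/-- **BASE-RELATIVE RE-INDEXING: the native identities of `i₁`'s class at the integers coprime to `3`.**
[cite: Yu2013, Lemma 5.4 (5.50)–(5.57)] [cite: Nesterenko2003, §4.3 (4.45), (4.50)–(4.51)] -/
theorem vanish_cop_reindex3R (Λ : S.G3Fam ι) {N T : ℕ}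
    (h : ∀ s : ℤ, |s| ≤ (N : ℤ) → ¬ (3 : ℤ) ∣ s → ∀ τ : Tau S.d, tauNorm τ < T →
      S.thirdVec Λ.R Λ.u Λ.uθ Λ.B Λ.p τ s = 0)
    (i₁ : ι) : (Λ.reindex3R i₁).vanish nodesCop N T := by
  classical
  intro x hx h3 τ hτ
  set Λ' := Λ.reindex3R i₁ with hΛ'
  have hc : (3 : ℚ) ^ τ.1 * S.qPart3 (Fin.snoc (Λ.u i₁) (Λ.uθ i₁)) x ≠ 0 :=
    mul_ne_zero (pow_ne_zero _ (by norm_num)) (S.qPart3_ne_zero _ x)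
  have hold : ∀ ν : Fin S.d → ℕ, (∀ j, ν j ≤ τ.2 j) →
      ∑ i ∈ Λ'.B, ((Λ.p i : ℚ) * (hasseDeriv τ.1 (Λ'.R i)).eval (x : ℚ) * S.zmon (Λ'.u i) (Λ'.uθ i) x : ℂ) *
        ∏ j, ((S.zγ (Λ.u i) (Λ.uθ i) j : ℚ) : ℂ) ^ ν j = 0 := by
    intro ν hν
    have hτ' : tauNorm ((τ.1, ν) : Tau S.d) < T := by
      have : ∑ j, ν j ≤ ∑ j, τ.2 j := Finset.sum_le_sum fun j _ => hν j
      unfold tauNorm at hτ ⊢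
      simp only at hτ ⊢
      omega
    have hvan := h x hx h3 (τ.1, ν) hτ'
    have hcls := congrFun hvan (S.res3 (Fin.snoc (Λ.u i₁) (Λ.uθ i₁)) x)
    rw [Pi.zero_apply, S.thirdVec_base_eq Λ i₁ (τ.1, ν) h3] at hcls
    have hsum := (mul_eq_zero.mp hcls).resolve_left hc
    have hcast := congrArg (fun q : ℚ => (q : ℂ)) hsum
    simp only [Rat.cast_zero, Rat.cast_sum] at hcast
    rw [← hcast]
    refine Finset.sum_congr rfl fun i _ => ?_
    unfold zγpow
    push_cast
    ring
  have hnew := GenThreeVanishing.sum_mul_prod_affine_pow_eq_zero Λ'.B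
    (fun i => ((Λ.p i : ℚ) * (hasseDeriv τ.1 (Λ'.R i)).eval (x : ℚ) * S.zmon (Λ'.u i) (Λ'.uθ i) x : ℂ))
    (fun i j => ((S.zγ (Λ.u i) (Λ.uθ i) j : ℚ) : ℂ))
    (fun _ => ((3⁻¹ : ℚ) : ℂ))
    (fun j => ((-(3⁻¹ : ℚ) * S.zγ (Λ.u i₁) (Λ.uθ i₁) j : ℚ) : ℂ))
    τ.2 hold
  have hγ : ∀ i ∈ Λ'.B, ∀ j : Fin S.d,
      ((3⁻¹ : ℚ) : ℂ) * ((S.zγ (Λ.u i) (Λ.uθ i) j : ℚ) : ℂ) +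
        ((-(3⁻¹ : ℚ) * S.zγ (Λ.u i₁) (Λ.uθ i₁) j : ℚ) : ℂ) = ((S.zγ (Λ'.u i) (Λ'.uθ i) j : ℚ) : ℂ) := by
    intro i hi j
    rw [Λ.zγ_eq_of_memR i₁ hi j]
    push_cast
    ring
  have hnew' : ∑ i ∈ Λ'.B,
      ((Λ.p i : ℚ) * (hasseDeriv τ.1 (Λ'.R i)).eval (x : ℚ) * S.zmon (Λ'.u i) (Λ'.uθ i) x : ℂ) *
        ∏ j, ((S.zγ (Λ'.u i) (Λ'.uθ i) j : ℚ) : ℂ) ^ τ.2 j = 0 := by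
    rw [← hnew]
    refine Finset.sum_congr rfl fun i hi => ?_
    congr 1
    exact Finset.prod_congr rfl fun j _ => by rw [hγ i hi j]
  have hfin : ((S.g3φ Λ'.R Λ'.u Λ'.uθ Λ'.B Λ'.p τ x : ℚ) : ℂ) = 0 := by
    rw [← hnew']
    unfold g3φ zγpow
    push_cast
    refine Finset.sum_congr rfl fun i _ => ?_
    have : Λ'.p = Λ.p := rfl
    rw [this]
    ring
  exact_mod_cast hfin

end TwoSetup

end Summit.ABC.StewartYu

end
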